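import Literature.NumberTheory.LFunctions.NicolasMertensRHProofs
import Literature.NumberTheory.LFunctions.NicolasJ
import HarnessLib

/-!
# Nicolas's integral `K(x) = ∫_x^∞ (θ(t) − t) t^{−2}(1/log t + 1/log² t) dt`:
# Lemma 2.1 (lower half) and Corollary 2.1 (upper half) of Nicolas 2012

Topic: `Literature/NumberTheory/LFunctions`. THEOREMS (everything proved, nothing asserted). J.-L.
Nicolas, *Small values of the Euler function and the Riemann hypothesis*, Acta Arith. 155 (2012),
311–321 (arXiv:1202.0729), (1.15): `K(x) = ∫_x^∞ S(t) t^{−2}(1/log t + 1/log² t) dt`, `S = θ − t`,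
the `θ`-companion of the integral `J(x)` ((1.16), `Literature.NumberTheory.LFunctions.NicolasJ.nicolasJ`,
`NicolasJ.lean`). This file supplies the two estimates through which `K` enters the RH-explicit
Mertens bound (2.18) (= the named fact `Literature.NumberTheory.LFunctions.Nicolas2012_logf_lower_sharp`,
`NicolasMertensRH.lean`, an input of Robin's and Lagarias's criteria):

* **The improper integral (1.15) exists unconditionally** and equals
  `K(x) = B₁ − ∑_{p ≤ x} 1/p + log log x + (θ(x) − x)/(x log x)` (`nicolasKInt`,
  `tendsto_integral_S_mul_w0`), `B₁` the Meissel–Mertens constant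
  (`Literature.NumberTheory.LFunctions.Mertens.meisselMertens`): indeed
  `∫_x^X S(t) w₀(t) dt = 𝒦(x) − 𝒦(X)` (`integral_S_mul_w0_eq`) for the *continuous* function
  `𝒦(x) = γ + log log x + (θ(x) − x)/(x log x) − ∑_{p ≤ x} 1/p` of the tree
  (`Literature.NumberTheory.LFunctions.Nicolas.nicolasK`, whose right derivative is `−S(x) w₀(x)`,
  `hasDerivWithinAt_nicolasK`), and `𝒦(X) → γ − B₁` by Mertens' second theorem with its constant
  (`Literature.NumberTheory.LFunctions.Mertens.tendsto_primeRecipSum_sub_loglog`).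
* **Lemma 2.1, lower half** (`lemma21_lower`; Nicolas 2012 (2.1) = Nicolas 1983, Prop. 1): for
  `x ≥ 121` with `θ(x) ≥ 4x/5` (Nicolas's standing input (1.14), Rosser–Schoenfeld:
  "`θ(x) ≥ 0.84 x ≥ (4/5) x` for `x ≥ 101`"),
  `K(x) − S(x)²/(x² log x) ≤ log f(x)`, `f = Literature.NumberTheory.LFunctions.nicolasF`.
  Proof: `log f(x) = γ + log log θ(x) − A(x)` (`Literature.NumberTheory.LFunctions.Nicolas.log_nicolasF_eq`),
  `A(x) − ∑_{p≤x} 1/p ≤ γ − B₁` (the defect `∑_{p ≤ x}(−log(1−1/p) − 1/p)` increases to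
  `∑_p (…) = γ − B₁`, Mertens), and the second-order Taylor bound
  `log log θ(x) ≥ log log x + S/(x log x) − S²/(x² log x)` (`loglog_taylor_lower`, valid once
  `log x ≥ 4.7` and `θ(x) ≥ 4x/5`).
* **Corollary 2.1, upper half** (`cor21_upper`; Nicolas 2012 (2.13)): if
  `ψ(t) − θ(t) ≤ √t + (4/3) t^{1/3}` for `t ≥ x` (Lemma 2.4 (2.12), the tree's
  `Literature.NumberTheory.LFunctions.Nicolas2012_lemma24_upper`) and `|ψ₁(t) − t²/2| ≤ C t^{3/2}`
  for `t ≥ x` (so that (1.16) converges, e.g. under RH), then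
  `J(x) − K(x) ≤ F_{1/2}(x) + (4/3) F_{1/3}(x)` (`F_z` = `Literature.NumberTheory.LFunctions.NicolasFz.Fz`).

Not here: the upper half of (2.1) (`log f ≤ K + 1/(2(x−1))`) and the lower half of (2.13)
(`F_{1/2} ≤ J − K`, from (2.11)), which (2.18) does not use; Lemma 2.5 (the explicit formula inside
`J`) is the sibling `NicolasJExplicit.lean` (to come).

## References

* J.-L. Nicolas, *Small values of the Euler function and the Riemann hypothesis*, Acta Arith. 155
  (2012), 311–321 (arXiv:1202.0729): (1.14), (1.15), Lemma 2.1 (2.1), Cor. 2.1 (2.13). [Nicolas2012]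
* J.-L. Nicolas, *Petites valeurs de la fonction d'Euler*, J. Number Theory 17 (1983), 375–388,
  §2, Prop. 1 and (5)–(6). [Nicolas1983]
* G. H. Hardy, E. M. Wright, *An Introduction to the Theory of Numbers*, 6th ed., Thms 427–428
  (Mertens' second theorem with its constant). [HardyWright2008]
-/

noncomputable section

open Filter Set MeasureTheory Topology intervalIntegral
open scoped Real Chebyshev

namespace Literature.NumberTheory.LFunctions

namespace NicolasK

open Nicolas Mertens NicolasJ NicolasFz

/-! ### `K(x)` in closed form -/

/-- **Nicolas's `K(x)`** ((1.15)), in the closed form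
`K(x) = 𝒦(x) − (γ − B₁) = B₁ − ∑_{p ≤ x} 1/p + log log x + (θ(x) − x)/(x log x)`; by
`tendsto_integral_S_mul_w0` this is the improper integral
`∫_x^∞ (θ(t) − t) t^{−2}(1/log t + 1/log² t) dt` for every `x > 1`. [cite: Nicolas2012, (1.15)] -/
def nicolasKInt (x : ℝ) : ℝ :=
  nicolasK x - (Real.eulerMascheroniConstant - meisselMertens)

/-- Unfolded form of `K`. [cite: Nicolas2012, (1.15)] -/
theorem nicolasKInt_eq (x : ℝ) :
    nicolasKInt x = meisselMertens - primeRecipSum x + Real.log (Real.log x) +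
      (θ x - x) / (x * Real.log x) := by
  rw [nicolasKInt, nicolasK]
  ring

/-! ### The right derivative of `𝒦` is `−S w₀` -/

/-- `Φ'` with `b = c = 0` is `−(θ₀ − x) w₀(x)`. [folklore] -/
theorem phiDeriv_zero_zero {θ₀ x : ℝ} (hx : 1 < x) :
    phiDeriv 0 0 θ₀ x = -((θ₀ - x) * w0 x) := by
  have hx0 : x ≠ 0 := by positivity
  have hl : Real.log x ≠ 0 := (Real.log_pos hx).ne'
  rw [phiDeriv, w0, NicolasFz.wt]
  field_simp
  ring

/-- On `[x, ⌊x⌋ + 1)` the step functions `θ` and `∑_{p ≤ ·} 1/p` are frozen, so `𝒦` agrees there with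
the smooth function `Φ` of the tree (`Literature.NumberTheory.LFunctions.Nicolas.phiAux`, `b = c = 0`).
[folklore] -/
theorem nicolasK_eq_phiAux_of_floor_eq {x z : ℝ} (h : ⌊z⌋₊ = ⌊x⌋₊) :
    nicolasK z = phiAux 0 0 (θ x) (Real.eulerMascheroniConstant - primeRecipSum x) z := by
  have h1 := nicolasK_sub_eq_phiAux 0 0 0 z
  simp only [sub_zero, zero_mul] at h1
  obtain ⟨hθz, hPz⟩ := theta_primeRecipSum_of_floor_eq h
  obtain ⟨hθx, hPx⟩ := theta_primeRecipSum_of_floor_eq (rfl : ⌊x⌋₊ = ⌊x⌋₊)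
  rw [h1, hθz, hPz, ← hθx, ← hPx]

/-- **The right derivative of `𝒦(x) = γ + log log x + (θ(x) − x)/(x log x) − ∑_{p≤x} 1/p` is
`−(θ(x) − x) w₀(x)`** at every `x > 1` (the jumps of the two step functions cancel, and between
integers `𝒦' = −θ · (1/(t log t))' − (log log t − 1/log t)' · 0 …`). [cite: Nicolas1983, §2, (9)–(10)] -/
theorem hasDerivWithinAt_nicolasK {x : ℝ} (hx : 1 < x) :
    HasDerivWithinAt nicolasK (-((θ x - x) * w0 x)) (Ioi x) x := by
  have hφ := (hasDerivAt_phiAux (b := 0) (c := 0) (θ₀ := θ x)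
    (C := Real.eulerMascheroniConstant - primeRecipSum x) hx).hasDerivWithinAt (s := Ioi x)
  rw [phiDeriv_zero_zero hx] at hφ
  refine hφ.congr_of_eventuallyEq ?_ (nicolasK_eq_phiAux_of_floor_eq rfl)
  have hlt : x < (⌊x⌋₊ : ℝ) + 1 := Nat.lt_floor_add_one x
  filter_upwards [Ioo_mem_nhdsGT hlt] with z hz
  have hx0 : 0 ≤ x := by linarith
  have hfl : ⌊z⌋₊ = ⌊x⌋₊ := by
    rw [Nat.floor_eq_iff (by linarith [hz.1])]
    exact ⟨(Nat.floor_le hx0).trans hz.1.le, hz.2⟩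
  exact nicolasK_eq_phiAux_of_floor_eq hfl

/-! ### `∫_x^X S w₀ = 𝒦(x) − 𝒦(X)` -/

/-- `(θ(t) − t) w₀(t)` is interval integrable on `[x, X] ⊂ (1, ∞)`. [folklore] -/
theorem intervalIntegrable_S_mul_w0 {x X : ℝ} (hx : 1 < x) (hxX : x ≤ X) :
    IntervalIntegrable (fun t ↦ (θ t - t) * w0 t) volume x X := by
  have hIcc : uIcc x X = Icc x X := uIcc_of_le hxX
  have hw0c : ContinuousOn w0 (uIcc x X) := by
    rw [hIcc]; exact continuousOn_w0.mono fun t ht ↦ hx.trans_le ht.1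
  exact (Chebyshev.theta_mono.intervalIntegrable.sub intervalIntegrable_id).mul_continuousOn hw0c

/-- `(ψ(t) − t) w₀(t)` is interval integrable on `[x, X] ⊂ (1, ∞)`. [folklore] -/
theorem intervalIntegrable_R_mul_w0 {x X : ℝ} (hx : 1 < x) (hxX : x ≤ X) :
    IntervalIntegrable (fun t ↦ (ψ t - t) * w0 t) volume x X := by
  have hIcc : uIcc x X = Icc x X := uIcc_of_le hxX
  have hw0c : ContinuousOn w0 (uIcc x X) := by
    rw [hIcc]; exact continuousOn_w0.mono fun t ht ↦ hx.trans_le ht.1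
  exact ((intervalIntegrable_psi x X).sub intervalIntegrable_id).mul_continuousOn hw0c

/-- **`∫_x^X (θ(t) − t) w₀(t) dt = 𝒦(x) − 𝒦(X)`** for `1 < x ≤ X` (fundamental theorem of calculus
for the continuous, right-differentiable `𝒦`). [cite: Nicolas2012, (1.15)] -/
theorem integral_S_mul_w0_eq {x X : ℝ} (hx : 1 < x) (hxX : x ≤ X) :
    ∫ t in x..X, (θ t - t) * w0 t = nicolasK x - nicolasK X := by
  have hcont : ContinuousOn nicolasK (Icc x X) := continuousOn_nicolasK hx
  have hderiv : ∀ t ∈ Ioo x X, HasDerivWithinAt nicolasK (-((θ t - t) * w0 t)) (Ioi t) t :=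
    fun t ht ↦ hasDerivWithinAt_nicolasK (hx.trans ht.1)
  have hint : IntervalIntegrable (fun t ↦ -((θ t - t) * w0 t)) volume x X :=
    (intervalIntegrable_S_mul_w0 hx hxX).neg
  have h := intervalIntegral.integral_eq_sub_of_hasDeriv_right_of_le hxX hcont hderiv hint
  rw [intervalIntegral.integral_neg] at h
  linarith

/-! ### `𝒦(X) → γ − B₁`, hence `∫_x^X S w₀ → K(x)` -/

/-- `(θ(X) − X)/(X log X) → 0` (Chebyshev: `0 ≤ θ(X) ≤ (log 4) X`). [folklore] -/
theorem tendsto_theta_sub_div :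
    Tendsto (fun X : ℝ ↦ (θ X - X) / (X * Real.log X)) atTop (𝓝 0) := by
  have hmaj : Tendsto (fun X : ℝ ↦ (Real.log X)⁻¹) atTop (𝓝 0) :=
    tendsto_inv_atTop_zero.comp Real.tendsto_log_atTop
  refine squeeze_zero_norm' ?_ hmaj
  filter_upwards [eventually_gt_atTop 1] with X hX
  have hX0 : 0 < X := by linarith
  have hlog : 0 < Real.log X := Real.log_pos hX
  have hθ0 := Chebyshev.theta_nonneg X
  have hθ1 := Chebyshev.theta_le_log4_mul_x hX0.le
  have h4 : Real.log 4 < 2 := by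
    have h : Real.log 4 = 2 * Real.log 2 := by
      rw [show (4 : ℝ) = 2 ^ 2 by norm_num, Real.log_pow]; norm_num
    rw [h]
    have := Real.log_two_lt_d9
    linarith
  have habs : |θ X - X| ≤ X := by
    rw [abs_le]; constructor <;> nlinarith
  rw [Real.norm_eq_abs, abs_div, abs_of_pos (mul_pos hX0 hlog), div_le_iff₀ (mul_pos hX0 hlog)]
  calc |θ X - X| ≤ X := habs
    _ = (Real.log X)⁻¹ * (X * Real.log X) := by field_simp

/-- **`𝒦(X) → γ − B₁`** as `X → ∞` (Mertens' second theorem with its constant,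
`∑_{p ≤ X} 1/p − log log X → B₁`). [cite: HardyWright2008, Thm 428 (§22.8)] -/
theorem tendsto_nicolasK_atTop :
    Tendsto nicolasK atTop (𝓝 (Real.eulerMascheroniConstant - meisselMertens)) := by
  have h := ((tendsto_const_nhds (x := Real.eulerMascheroniConstant)).sub
    tendsto_primeRecipSum_sub_loglog).add tendsto_theta_sub_div
  rw [add_zero] at h
  refine h.congr' (Eventually.of_forall fun X ↦ ?_)
  simp only [nicolasK]
  ring

/-- **The improper integral (1.15) converges to `K(x)`**: for `x > 1`,
`∫_x^X (θ(t) − t) w₀(t) dt → K(x)` as `X → ∞` (unconditionally). [cite: Nicolas2012, (1.15)] -/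
theorem tendsto_integral_S_mul_w0 {x : ℝ} (hx : 1 < x) :
    Tendsto (fun X : ℝ ↦ ∫ t in x..X, (θ t - t) * w0 t) atTop (𝓝 (nicolasKInt x)) := by
  have h := (tendsto_const_nhds (x := nicolasK x)).sub tendsto_nicolasK_atTop
  refine h.congr' ?_
  filter_upwards [eventually_ge_atTop x] with X hX
  rw [integral_S_mul_w0_eq hx hX]

/-! ### The Mertens defect is below its limit `γ − B₁` -/

/-- `∑_p (−log(1 − 1/p) − 1/p) = γ − B₁`. [cite: HardyWright2008, Thm 428 (§22.8) eq. (22.8.1)] -/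
theorem tsum_primeLogCoeffSubInv_eq :
    ∑' k, primeLogCoeffSubInv k = Real.eulerMascheroniConstant - meisselMertens := by
  rw [tsum_primeLogCoeffSubInv, meisselMertens]
  ring

/-- `A(x) − ∑_{p ≤ x} 1/p ≤ γ − B₁` (the defect increases to its limit). [cite: HardyWright2008, §22.8, proof of Thm 429] -/
theorem mertensDefect_le_limit (x : ℝ) :
    mertensLog x - primeRecipSum x ≤ Real.eulerMascheroniConstant - meisselMertens := by
  have ht := tendsto_mertensLog_sub_primeRecipSum
  rw [tsum_primeLogCoeffSubInv_eq] at ht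
  have hmono : Monotone fun x ↦ mertensLog x - primeRecipSum x :=
    fun a b hab ↦ mertensDefect_mono hab
  exact hmono.ge_of_tendsto ht x

/-! ### The second-order Taylor bound for `log log θ(x)` -/

/-- `log(1 − z) ≥ −z − z²/2 − z³/(1 − z)` for `0 ≤ z < 1` (two terms of the series, Mathlib's
`Real.abs_log_sub_add_sum_range_le`). [folklore] -/
theorem log_one_sub_ge {z : ℝ} (hz0 : 0 ≤ z) (hz1 : z < 1) :
    -z - z ^ 2 / 2 - z ^ 3 / (1 - z) ≤ Real.log (1 - z) := by
  have habs : |z| < 1 := by rwa [abs_of_nonneg hz0]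
  have h := Real.abs_log_sub_add_sum_range_le habs 2
  have hs : (∑ i ∈ Finset.range 2, z ^ (i + 1) / (i + 1)) = z + z ^ 2 / 2 := by
    norm_num [Finset.sum_range_succ]
  rw [hs, abs_of_nonneg hz0] at h
  have := (abs_le.1 h).1
  linarith

/-- `log(1 + s) ≥ s − s²/2` for `s ≥ 0` (from Mathlib's `2s/(s+2) ≤ log(1+s)`). [folklore] -/
theorem log_one_add_ge {s : ℝ} (hs : 0 ≤ s) : s - s ^ 2 / 2 ≤ Real.log (1 + s) := by
  refine le_trans ?_ (Real.le_log_one_add_of_nonneg hs)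
  rw [le_div_iff₀ (by linarith)]
  nlinarith [sq_nonneg s, mul_nonneg hs (sq_nonneg s)]

/-- The core inequality behind the Taylor bound: for `L ≥ 4.7` and `s ≥ −1/5`,
`s/L − s²/L ≤ log(1 + log(1+s)/L)`. [folklore] -/
theorem core_taylor {L s : ℝ} (hL : 47 / 10 ≤ L) (hs : -(1 / 5 : ℝ) ≤ s) :
    s / L - s ^ 2 / L ≤ Real.log (1 + Real.log (1 + s) / L) := by
  have hL0 : 0 < L := by linarith
  have h1s : 0 < 1 + s := by linarith
  obtain ⟨v, hvdef⟩ : ∃ v : ℝ, v = Real.log (1 + s) := ⟨_, rfl⟩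
  rw [← hvdef]
  obtain ⟨w, hwdef⟩ : ∃ w : ℝ, w = v / L := ⟨_, rfl⟩
  rw [← hwdef]
  have hvw : v = w * L := by rw [hwdef]; field_simp
  rcases le_or_gt 0 s with hs0 | hs0
  · -- `s ≥ 0`: `v ∈ [s − s²/2, s]`, `w ≥ 0`, `log(1+w) ≥ w − w²/2`
    have hv1 : s - s ^ 2 / 2 ≤ v := hvdef ▸ log_one_add_ge hs0
    have hv2 : v ≤ s := by
      have := Real.log_le_sub_one_of_pos h1s
      rw [hvdef]; linarith
    have hv0 : 0 ≤ v := hvdef ▸ Real.log_nonneg (by linarith)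
    have hw0 : 0 ≤ w := by rw [hwdef]; exact div_nonneg hv0 hL0.le
    have hlw : w - w ^ 2 / 2 ≤ Real.log (1 + w) := log_one_add_ge hw0
    have hwL : (w * L) ^ 2 ≤ s ^ 2 := by
      rw [← hvw]; exact pow_le_pow_left₀ hv0 hv2 2
    have hkey : s / L - s ^ 2 / L ≤ w - w ^ 2 / 2 := by
      rw [div_sub_div_same, div_le_iff₀ hL0]
      have h1 : s - s ^ 2 / 2 ≤ w * L := hvw ▸ hv1
      have h2 : w ^ 2 * L ≤ s ^ 2 := by
        have h47 : w ^ 2 * L ≤ w ^ 2 * L * L := by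
          have hw2 : 0 ≤ w ^ 2 * L := by positivity
          nlinarith
        nlinarith
      nlinarith
    linarith
  · -- `s < 0`: write `s = −z`, `z ∈ (0, 1/5]`
    obtain ⟨z, hzdef⟩ : ∃ z : ℝ, z = -s := ⟨_, rfl⟩
    have hs' : s = -z := by rw [hzdef]; ring
    subst hs'
    have hz0 : 0 < z := by linarith
    have hz5 : z ≤ 1 / 5 := by linarith
    have hz1 : z < 1 := by linarith
    have hsz : (1 + -z : ℝ) = 1 - z := by ring
    -- `v = log(1 − z) ∈ [−z − (3/4) z², −z]`
    have hv1 : -z - 3 / 4 * z ^ 2 ≤ v := by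
      have h := log_one_sub_ge hz0.le hz1
      have h3 : z ^ 3 / (1 - z) ≤ z ^ 2 / 4 := by
        rw [div_le_iff₀ (by linarith)]
        nlinarith [sq_nonneg z]
      rw [hvdef, hsz]; linarith
    have hv2 : v ≤ -z := by
      have := Real.log_le_sub_one_of_pos h1s
      rw [hvdef]; linarith
    -- `w = v/L ∈ [−(z + (3/4)z²)/L, −z/L]`, `|w| ≤ 1/10`
    have hwneg : w ≤ 0 := by rw [hwdef]; exact div_nonpos_of_nonpos_of_nonneg (by linarith) hL0.le
    have hwlo : -w ≤ (z + 3 / 4 * z ^ 2) / L := by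
      rw [hwdef, ← neg_div]; exact div_le_div_of_nonneg_right (by linarith) hL0.le
    have hzb : z + 3 / 4 * z ^ 2 ≤ 23 / 20 * z := by nlinarith
    have hA : -w ≤ (23 / 20 * z) / L :=
      hwlo.trans (div_le_div_of_nonneg_right hzb hL0.le)
    have hwabs : -w ≤ 1 / 10 := by
      have h2 : (23 / 20 * z) / L ≤ (23 / 20 * (1 / 5)) / (47 / 10) :=
        div_le_div₀ (by norm_num) (by linarith) (by norm_num) hL
      linarith [show (23 / 20 * (1 / 5) : ℝ) / (47 / 10) ≤ 1 / 10 by norm_num]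
    -- `log(1 + w) = log(1 − z') ≥ −z' − (2/3) z'²`, `z' = −w ∈ [0, 1/10]`
    have hlw : w - 2 / 3 * w ^ 2 ≤ Real.log (1 + w) := by
      have hz'0 : 0 ≤ -w := by linarith
      have hz'1 : -w < 1 := by linarith
      have h := log_one_sub_ge hz'0 hz'1
      rw [show (1 - -w : ℝ) = 1 + w by ring] at h
      have h3 : (-w) ^ 3 / (1 + w) ≤ (-w) ^ 2 / 9 := by
        rw [div_le_iff₀ (by linarith)]
        nlinarith [sq_nonneg w]
      nlinarith [h, h3, sq_nonneg w]
    -- `w² ≤ (23/20)² z²/L²` and `(2/3)(23/20)²/L ≤ 1/4`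
    have hw2 : w ^ 2 ≤ (23 / 20 * z) ^ 2 / L ^ 2 := by
      have hB : 0 ≤ -w := by linarith
      calc w ^ 2 = (-w) ^ 2 := by ring
        _ ≤ ((23 / 20 * z) / L) ^ 2 := pow_le_pow_left₀ hB hA 2
        _ = (23 / 20 * z) ^ 2 / L ^ 2 := by rw [div_pow]
    have hkey : -z / L - (-z) ^ 2 / L ≤ w - 2 / 3 * w ^ 2 := by
      have h1 : 2 / 3 * w ^ 2 ≤ z ^ 2 / (4 * L) := by
        have hc : 2 / 3 * ((23 / 20 * z) ^ 2 / L ^ 2) ≤ z ^ 2 / (4 * L) := by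
          rw [show 2 / 3 * ((23 / 20 * z) ^ 2 / L ^ 2) = (2 / 3 * (23 / 20 * z) ^ 2) / L ^ 2 by ring,
            div_le_div_iff₀ (by positivity) (by positivity)]
          have hz2 : 0 ≤ z ^ 2 := sq_nonneg z
          nlinarith [mul_nonneg (mul_nonneg hz2 hL0.le) (sub_nonneg.2 hL), mul_nonneg hz2 hL0.le]
        linarith
      have h2 : -z / L - (-z) ^ 2 / L = -((z + 3 / 4 * z ^ 2) / L) - z ^ 2 / (4 * L) := by
        field_simp; ring
      have h4 : -((z + 3 / 4 * z ^ 2) / L) ≤ w := by linarith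
      rw [h2]
      linarith
    linarith

/-- **Second-order Taylor bound** (the shape of Nicolas 1983, (5)–(6)): if `log x ≥ 4.7` and
`y ≥ 4x/5` then `log log y ≥ log log x + (y − x)/(x log x) − (y − x)²/(x² log x)`.
[cite: Nicolas1983, §2, (5)–(6)] -/
theorem loglog_taylor_lower {x y : ℝ} (hx : 1 < x) (hL : 47 / 10 ≤ Real.log x)
    (hy : 4 / 5 * x ≤ y) :
    Real.log (Real.log x) + (y - x) / (x * Real.log x) - (y - x) ^ 2 / (x ^ 2 * Real.log x)
      ≤ Real.log (Real.log y) := by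
  have hx0 : 0 < x := by linarith
  obtain ⟨L, hLdef⟩ : ∃ L : ℝ, L = Real.log x := ⟨_, rfl⟩
  rw [← hLdef] at hL ⊢
  have hL0 : 0 < L := by linarith
  obtain ⟨s, hsdef⟩ : ∃ s : ℝ, s = (y - x) / x := ⟨_, rfl⟩
  have hs : -(1 / 5 : ℝ) ≤ s := by
    rw [hsdef, le_div_iff₀ hx0]; linarith
  have hyx : y = x * (1 + s) := by rw [hsdef]; field_simp; ring
  have h1s : 0 < 1 + s := by linarith
  -- `log y = L + log (1 + s)` and `L + log(1+s) > 0`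
  have hlogy : Real.log y = L + Real.log (1 + s) := by
    rw [hyx, Real.log_mul hx0.ne' h1s.ne', hLdef]
  have hv_lo0 : -(1 : ℝ) < Real.log (1 + s) := by
    have h45 : Real.log (4 / 5) ≤ Real.log (1 + s) := Real.log_le_log (by norm_num) (by linarith)
    have h45' : -(1 : ℝ) < Real.log (4 / 5) := by
      have := Real.one_sub_inv_le_log_of_pos (show (0 : ℝ) < 4 / 5 by norm_num)
      norm_num at this
      linarith
    linarith
  have hLv : 0 < L + Real.log (1 + s) := by linarith
  have hgoal : (y - x) / (x * L) = s / L := by rw [hsdef]; field_simp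
  have hgoal2 : (y - x) ^ 2 / (x ^ 2 * L) = s ^ 2 / L := by rw [hsdef]; field_simp
  rw [hgoal, hgoal2, hlogy]
  have h1w : (1 + Real.log (1 + s) / L) = (L + Real.log (1 + s)) / L := by field_simp
  have hsplit : Real.log (L + Real.log (1 + s)) = Real.log L + Real.log (1 + Real.log (1 + s) / L) := by
    rw [← Real.log_mul hL0.ne' (by rw [h1w]; positivity), h1w]
    congr 1
    field_simp
  rw [hsplit]
  have := core_taylor hL hs
  linarith

/-- `log 121 ≥ 4.7` (`log 11 ≥ 3 log 2 + (1 − 8/11)`). [folklore] -/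
theorem log_121_ge : (47 / 10 : ℝ) ≤ Real.log 121 := by
  have h1 : Real.log 121 = 2 * Real.log 11 := by
    rw [show (121 : ℝ) = 11 ^ 2 by norm_num, Real.log_pow]; norm_num
  have h2 : Real.log 11 = 3 * Real.log 2 + Real.log (11 / 8) := by
    rw [show (11 : ℝ) = 2 ^ 3 * (11 / 8) by norm_num, Real.log_mul (by norm_num) (by norm_num),
      Real.log_pow]; norm_num
  have h3 : 1 - (11 / 8 : ℝ)⁻¹ ≤ Real.log (11 / 8) := Real.one_sub_inv_le_log_of_pos (by norm_num)
  have h4 := Real.log_two_gt_d9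
  rw [h1, h2]
  norm_num at h3 ⊢
  linarith

/-! ### Lemma 2.1, lower half -/

/-- **Nicolas 2012, Lemma 2.1 (2.1), lower half** (= Nicolas 1983, Prop. 1): for `x ≥ 121` with
`θ(x) ≥ 4x/5` ((1.14)), `K(x) − S(x)²/(x² log x) ≤ log f(x)`, where `S = θ(x) − x` and
`f(x) = e^γ log θ(x) ∏_{p ≤ x}(1 − 1/p)`. [cite: Nicolas2012, Lemma 2.1 (2.1)] -/
theorem lemma21_lower {x : ℝ} (hx : 121 ≤ x) (hθ : 4 / 5 * x ≤ θ x) :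
    nicolasKInt x - (θ x - x) ^ 2 / (x ^ 2 * Real.log x) ≤ Real.log (nicolasF x) := by
  have hx3 : (3 : ℝ) ≤ x := by linarith
  have hL : 47 / 10 ≤ Real.log x :=
    log_121_ge.trans (Real.log_le_log (by norm_num) hx)
  rw [log_nicolasF_eq hx3, nicolasKInt_eq]
  have hu : mertensLog x - primeRecipSum x ≤ Real.eulerMascheroniConstant - meisselMertens :=
    mertensDefect_le_limit x
  have ht := loglog_taylor_lower (by linarith) hL hθ
  linarith

/-! ### Corollary 2.1, upper half -/

/-- For real `a < 1` and `1 < x ≤ X`: `∫_x^X t^a w₀(t) dt ≤ F_a(x)` (the integrand of `F_a` is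
non-negative). [cite: Nicolas2012, (1.17)] -/
theorem integral_rpow_mul_w0_le_Fz {a x X : ℝ} (ha : a < 1) (hx : 1 < x) (hxX : x ≤ X) :
    ∫ t in x..X, t ^ a * w0 t ≤ (Fz a x).re := by
  have hx0 : 0 < x := by linarith
  have heq : ∀ t ∈ Ioi x, t ^ (a - 2) * wt t = t ^ a * w0 t := by
    intro t ht
    have ht0 : 0 < t := hx0.trans ht
    rw [Real.rpow_sub ht0, Real.rpow_two, w0]
    ring
  have hintC := integrableOn_Fz (z := (a : ℂ)) (x := x) (by simpa using ha) hx
  have hintR : IntegrableOn (fun t : ℝ ↦ t ^ (a - 2) * wt t) (Ioi x) := by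
    have h2 : IntegrableOn (fun t : ℝ ↦ (((t ^ (a - 2) * wt t : ℝ)) : ℂ)) (Ioi x) :=
      hintC.congr_fun (fun t ht ↦ integrand_ofReal (hx0.trans ht)) measurableSet_Ioi
    have h3 : Integrable (fun t : ℝ ↦ t ^ (a - 2) * wt t) (volume.restrict (Ioi x)) := by
      simpa using h2.re
    exact h3
  have hintR' : IntegrableOn (fun t : ℝ ↦ t ^ a * w0 t) (Ioi x) :=
    hintR.congr_fun heq measurableSet_Ioi
  rw [Fz_ofReal hx, Complex.ofReal_re, setIntegral_congr_fun measurableSet_Ioi heq,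
    intervalIntegral.integral_of_le hxX]
  refine setIntegral_mono_set hintR' ?_ Ioc_subset_Ioi_self.eventuallyLE
  refine (ae_restrict_iff' measurableSet_Ioi).2 (ae_of_all _ fun t ht ↦ ?_)
  have ht1 : 1 < t := hx.trans ht
  exact mul_nonneg (Real.rpow_nonneg (by linarith) _) (w0_pos ht1).le

/-- `t ↦ t^a w₀(t)` is continuous on `[x, X] ⊂ (1, ∞)`, hence interval integrable. [folklore] -/
theorem intervalIntegrable_rpow_mul_w0 (a : ℝ) {x X : ℝ} (hx : 1 < x) (hxX : x ≤ X) :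
    IntervalIntegrable (fun t : ℝ ↦ t ^ a * w0 t) volume x X := by
  refine ContinuousOn.intervalIntegrable ?_
  rw [uIcc_of_le hxX]
  refine ContinuousOn.mul ?_ (continuousOn_w0.mono fun t ht ↦ hx.trans_le ht.1)
  exact ContinuousOn.rpow_const continuousOn_id fun t ht ↦ Or.inl (by linarith [ht.1] : (t : ℝ) ≠ 0)

/-- **Nicolas 2012, Corollary 2.1 (2.13), upper half**: if `ψ(t) − θ(t) ≤ √t + (4/3) t^{1/3}` for
all `t ≥ x > 1` (Lemma 2.4, (2.12)) and `|ψ₁(t) − t²/2| ≤ C t^{3/2}` for `t ≥ x` (convergence of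
(1.16)), then `J(x) − K(x) ≤ F_{1/2}(x) + (4/3) F_{1/3}(x)`. [cite: Nicolas2012, Cor. 2.1 (2.13)] -/
theorem cor21_upper {x C : ℝ} (hx : 1 < x)
    (hR : ∀ t, x ≤ t → |Rone t| ≤ C * t ^ (3 / 2 : ℝ))
    (hψθ : ∀ t, x ≤ t → ψ t - θ t ≤ Real.sqrt t + 4 / 3 * t ^ ((1 : ℝ) / 3)) :
    nicolasJ x - nicolasKInt x ≤ (Fz (1 / 2 : ℝ) x).re + 4 / 3 * (Fz (1 / 3 : ℝ) x).re := by
  have hlim := (tendsto_integral_R_mul_w0 hx hR).sub (tendsto_integral_S_mul_w0 hx)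
  refine le_of_tendsto hlim ?_
  filter_upwards [eventually_ge_atTop x] with X hX
  have hiψ := intervalIntegrable_R_mul_w0 hx hX
  have hiθ := intervalIntegrable_S_mul_w0 hx hX
  have hi2 := intervalIntegrable_rpow_mul_w0 (1 / 2) hx hX
  have hi3 := intervalIntegrable_rpow_mul_w0 (1 / 3) hx hX
  rw [← intervalIntegral.integral_sub hiψ hiθ]
  have hsimp : ∫ t in x..X, ((ψ t - t) * w0 t - (θ t - t) * w0 t) =
      ∫ t in x..X, (ψ t - θ t) * w0 t :=
    intervalIntegral.integral_congr fun t _ ↦ by ring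
  rw [hsimp]
  have hmono : ∫ t in x..X, (ψ t - θ t) * w0 t ≤
      ∫ t in x..X, (t ^ (1 / 2 : ℝ) * w0 t + 4 / 3 * (t ^ ((1 : ℝ) / 3) * w0 t)) := by
    refine intervalIntegral.integral_mono_on hX (hiψ.sub hiθ |>.congr ?_) (hi2.add (hi3.const_mul _))
      fun t ht ↦ ?_
    · exact fun t _ ↦ by ring
    · have ht1 : 1 < t := hx.trans_le ht.1
      have h := hψθ t ht.1
      rw [Real.sqrt_eq_rpow] at h
      have hw := (w0_pos ht1).le
      calc (ψ t - θ t) * w0 t ≤ (t ^ (1 / 2 : ℝ) + 4 / 3 * t ^ ((1 : ℝ) / 3)) * w0 t :=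
            mul_le_mul_of_nonneg_right h hw
        _ = _ := by ring
  refine hmono.trans ?_
  rw [intervalIntegral.integral_add hi2 (hi3.const_mul _), intervalIntegral.integral_const_mul]
  have h2 := integral_rpow_mul_w0_le_Fz (a := 1 / 2) (by norm_num) hx hX
  have h3 := integral_rpow_mul_w0_le_Fz (a := (1 : ℝ) / 3) (by norm_num) hx hX
  have h3' : 4 / 3 * ∫ t in x..X, t ^ ((1 : ℝ) / 3) * w0 t ≤ 4 / 3 * (Fz (1 / 3 : ℝ) x).re := by
    rw [show ((1 : ℝ) / 3) = (1 / 3 : ℝ) by norm_num] at h3 ⊢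
    linarith
  linarith

end NicolasK

end Literature.NumberTheory.LFunctions

end
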